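import Summits.NavierStokesRegularity.NavierStokesRegularity.Theorems.TerminalTraceTypeITraceScarL3LoudDustUniformlyPerfect
import Summits.NavierStokesRegularity.NavierStokesRegularity.Theorems.TerminalTraceTypeITraceScarL3TopSingularNull
import Summits.NavierStokesRegularity.NavierStokesRegularity.Theorems.TerminalTraceTypeITraceScarL3StubLocalTypeIOfTypeIBlowup
import Literature.Analysis.FluidPDE.LocalTypeI
import HarnessLib

/-!
# The √2-apex WINDOW of ROUND-27 (T27-B, T27-C): conditional kernel records
# (item `TerminalTrace.TypeITraceScarL3`, stmt-NavierStokesRegularity-18385, Stub LOUD line; helpers)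

Seat nsreg-C26-p1 g2 (cell ns-regularity-ideate), `--supports stmt-NavierStokesRegularity-18385` (helper);
planner-of-record nsreg-p2 g29 (ROUND-27 «THE √2 APEX», companion `R27-sqrt2-apex.lean` v2, sha16
1e24a2a485d38e8d, where the same theorems are kernel-checked inside the `Cruxes.…SqrtTwoApex` namespace with
the hypotheses abbreviated as `RateSqThreshold` / `ExtinctApexDOfL3TraceConst`).  Here the two hypotheses are
SPELLED OUT (no `def … : Prop` in a proof file), so each record is literally «T27-A ⇒ …».

* `hausdorffMeasure_ne_zero_of_meets_every_shell` (unconditional; the sphere trick) — a closed `S ⊆ ℝ³`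
  meeting the closed shell `{R ≤ |y − x| ≤ A R}` for every `R ∈ ]0,1[` and every ratio `A > 1` has
  `μH[1] S ≠ 0` (the `1`-Lipschitz `y ↦ dist y x` maps `S ∩ B̄(x,2)` onto a closed set containing `]0,1[`).
* **T27-B** `no_topSingular_of_rateSq_lt_two` — IF T27-A holds (hypothesis `hT`: an extinct Type-I apex of
  class `(M, D₀, C)` that is backward singular at the origin and quiet on one shell slab of any ratio `A > 1`
  has `2 ≤ C²`), THEN an extinct Type-I apex of a class with `C² < 2` has NO backward-singular point on the
  top slice: otherwise every closed shell about a singular `x`, of every ratio, meets the top singular set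
  `Σ₀` (`exists_topSingular_mem_shell_of_quietShellExclusion`), `Σ₀` is closed (`isClosed_topSingularSet`),
  so `μH[1] Σ₀ ≠ 0` by the sphere trick — against CKN at the top (`hausdorffMeasure_topSingular_apex_eq_zero`).
* `stub_no_loudShellExtinctApex_of_rateSq_lt_two` — the registered LOUD stub `stub_no_loudShellExtinctApex`
  of skeleton v4 (3f7a14107033987a) VERBATIM with the two extra hypotheses `hT` and `C ^ 2 < 2` in front
  (neither the quiet-shell-exclusion premise nor the loudness premise is used).
* `no_extinctTypeIApex_of_rateSq_lt_two` — Stub C in the window: no backward-singular extinct Type-I apex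
  at all in a class with `C² < 2`, given `hT`.
* **T27-C** `typeITraceScarL3_of_rateSq_lt_two_nu` — IF T27-A holds AND the constant-exposed Stub 2′ holds
  (hypothesis `hZ`: a backward-singular apex of a classical Leray–Hopf flow with EVENTUAL Type-I constant
  `C ≥ 0` and an `L³` terminal trace yields an extinct Type-I apex of class `(M, D₀, C/√ν)` singular at the
  origin), THEN item 18385's conclusion holds for every blow-up whose eventual Type-I constant satisfies
  `C² < 2ν`: no singular point carries a local `L³` trace (uses the landed Stub 1
  `stub_localTypeI_of_typeIBlowup` by name; `max C 0` handles a negative constant).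

In print the Type-I constant at a blow-up is only known to be `≥ √ν/(8γ₃)` (Leray 1934; arXiv:2111.03520
Thm 2.5), so the window `C/√ν ∈ [0.11, √2)` is non-empty.  WHAT THIS IS NOT: not T27-A, not the constant-exposed
Stub 2′, not Stub LOUD, not item 18385, not NS regularity — conditional records and one lemma on Hausdorff
measure.  [folklore; CaffarelliKohnNirenberg1982 Thm B; Leray1934]
-/

noncomputable section

set_option linter.dupNamespace false

namespace Summit.NavierStokesRegularity.NavierStokesRegularity.Theorems.TypeITraceScarL3

open MeasureTheory Set Function Filter Topology Metric
open Literature.Analysis.FluidPDE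
open scoped NNReal ENNReal InnerProductSpace RealInnerProductSpace

/-- **The sphere trick.**  A closed set `S ⊆ ℝ³` that meets the closed shell `{R ≤ |y − x| ≤ A R}` for
every `R ∈ ]0,1[` and every ratio `A > 1` has `μH[1] S ≠ 0`: the `1`-Lipschitz map `y ↦ dist y x`
sends `S ∩ B̄(x, 2)` onto a closed set containing `]0, 1[`. [folklore] -/
theorem hausdorffMeasure_ne_zero_of_meets_every_shell
    {S : Set (EuclideanSpace ℝ (Fin 3))} (hS : IsClosed S) (x : EuclideanSpace ℝ (Fin 3))
    (h : ∀ R : ℝ, 0 < R → R < 1 → ∀ A : ℝ, 1 < A →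
      ∃ y ∈ S, R ≤ ‖y - x‖ ∧ ‖y - x‖ ≤ A * R) :
    μH[1] S ≠ 0 := by
  classical
  set T : Set (EuclideanSpace ℝ (Fin 3)) := S ∩ closedBall x 2 with hT
  have hTc : IsCompact T := (isCompact_closedBall x 2).inter_left hS
  set f : EuclideanSpace ℝ (Fin 3) → ℝ := fun y => dist y x with hf
  have hfL : LipschitzWith 1 f := LipschitzWith.dist_left x
  have hfc : Continuous f := hfL.continuous
  -- every `R ∈ ]0,1[` is a value of `f` on `T`
  have hsub : Ioo (0 : ℝ) 1 ⊆ f '' T := by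
    intro R hR
    have himc : IsClosed (f '' T) := (hTc.image hfc).isClosed
    rw [← himc.closure_eq, Metric.mem_closure_iff]
    intro ε hε
    -- shrink `ε` to `ε' = min ε 1` and use the ratio `A = 1 + ε'/2`
    set ε' : ℝ := min ε 1 with hε'
    have hε'pos : 0 < ε' := lt_min hε one_pos
    have hε'le1 : ε' ≤ 1 := min_le_right _ _
    have hε'leε : ε' ≤ ε := min_le_left _ _
    obtain ⟨y, hyS, hy1, hy2⟩ := h R hR.1 hR.2 (1 + ε' / 2) (by linarith)
    have hyx : dist y x = ‖y - x‖ := dist_eq_norm y x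
    refine ⟨f y, ⟨y, ⟨hyS, ?_⟩, rfl⟩, ?_⟩
    · rw [mem_closedBall, hyx]
      nlinarith [hR.1, hR.2]
    · show dist R (f y) < ε
      simp only [hf, hyx]
      rw [dist_comm, Real.dist_eq, abs_of_nonneg (by linarith)]
      nlinarith [hR.1, hR.2]
  have hpos : 0 < μH[1] (f '' T) := by
    have h1 : 0 < μH[1] (Ioo (0 : ℝ) 1) := by
      rw [hausdorffMeasure_real, Real.volume_Ioo]
      norm_num
    exact h1.trans_le (measure_mono hsub)
  have hle : μH[1] (f '' T) ≤ μH[1] T := by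
    have := hfL.hausdorffMeasure_image_le zero_le_one T
    simpa only [ENNReal.coe_one, ENNReal.one_rpow, one_mul] using this
  intro hS0
  have hT0 : μH[1] T = 0 := measure_mono_null inter_subset_left hS0
  have : (0 : ℝ≥0∞) < 0 := by
    calc (0 : ℝ≥0∞) < μH[1] (f '' T) := hpos
      _ ≤ μH[1] T := hle
      _ = 0 := hT0
  exact lt_irrefl _ this

section RateSqThreshold

/-! Throughout this section `hT` is HYPOTHESIS T27-A «the √2 apex» (`RateSqThreshold` of the companion file,
spelled out): an extinct Type-I apex of class `(M, D₀, C)` that is backward singular at the origin and QUIET on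
some shell slab `]−δ,0[ × {R < |y| < A R}` of ANY ratio `A > 1` has `2 ≤ C²`.  Every theorem of the section
takes `hT` as its first explicit argument (conditional kernel records). -/

variable
  (hT : ∀ (M D₀ : ℝ≥0) (C : ℝ)
      (U : ℝ → EuclideanSpace ℝ (Fin 3) → EuclideanSpace ℝ (Fin 3))
      (P : ℝ → EuclideanSpace ℝ (Fin 3) → ℝ)
      (G : ℝ → EuclideanSpace ℝ (Fin 3) →
        EuclideanSpace ℝ (Fin 3) →L[ℝ] EuclideanSpace ℝ (Fin 3)),
      (∀ a : ℝ, 0 < a →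
        IsSuitableWeakSolutionInBall a (0 : ℝ × EuclideanSpace ℝ (Fin 3)) U P) →
      (∀ a : ℝ, 0 < a →
        HasWeakSpatialGradientOn
          (parabolicCylinderOpens a (0 : ℝ × EuclideanSpace ℝ (Fin 3))) U G) →
      (∀ a : ℝ, 0 < a →
        typeIBound (parabolicCylinder a (0 : ℝ × EuclideanSpace ℝ (Fin 3))) U P G ≤ M) →
      (∀ z₀ : ℝ × EuclideanSpace ℝ (Fin 3), z₀.1 ≤ 0 →
        ∀ r : ℝ, 0 < r → cknD r z₀ P ≤ D₀) →
      (∀ s : ℝ, s < 0 →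
        ∀ᵐ y : EuclideanSpace ℝ (Fin 3), ‖U s y‖ ≤ C / Real.sqrt (-s)) →
      (∀ φ : EuclideanSpace ℝ (Fin 3) → EuclideanSpace ℝ (Fin 3),
        ContDiff ℝ (⊤ : ℕ∞) φ →
        HasCompactSupport φ → ∀ ε : ℝ, 0 < ε →
        ∃ s₀ : ℝ, s₀ < 0 ∧ ∀ᵐ s ∂(volume.restrict (Ioo s₀ 0)), |∫ y, ⟪U s y, φ y⟫| ≤ ε) →
      IsBackwardSingularPoint U (0 : ℝ × EuclideanSpace ℝ (Fin 3)) →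
      ∀ (A R δ K : ℝ), 1 < A → 0 < R → 0 < δ →
        (∀ᵐ z ∂(volume.restrict
          (Ioo (-δ) 0 ×ˢ {y : EuclideanSpace ℝ (Fin 3) | R < ‖y‖ ∧ ‖y‖ < A * R})),
            ‖U z.1 z.2‖ ≤ K) →
        2 ≤ C ^ 2)

include hT

/-- **T27-B (conditional record).**  IF T27-A «the √2 apex» holds — hypothesis `hT`: an extinct Type-I apex
of class `(M, D₀, C)` (suitable in every `Q(a)` at the origin, weak gradient, `𝐈(Q(a)) ≤ M`, `D ≤ D₀` at
apices, rate `C/√(−s)`, weakly null top) that is backward singular at the origin and QUIET on some shell slab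
`]−δ,0[ × {R < |y| < A R}` of ANY ratio `A > 1` has `2 ≤ C²` — THEN an extinct Type-I apex of a class with
`C² < 2` has NO backward-singular point on the top slice `{s = 0}`.  Proof: were `x` singular, `hT` for the
translates (inside `exists_topSingular_mem_shell_of_quietShellExclusion`) would make every closed shell about
`x`, of every ratio, meet the top singular set `Σ₀`; `Σ₀` is closed (`isClosed_topSingularSet`), so by the
sphere trick `μH[1] Σ₀ ≠ 0` — against CKN at the top (`hausdorffMeasure_topSingular_apex_eq_zero`).
[folklore; CaffarelliKohnNirenberg1982 Thm B] -/
theorem no_topSingular_of_rateSq_lt_two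
    {M D₀ : ℝ≥0} {C : ℝ}
    {U : ℝ → EuclideanSpace ℝ (Fin 3) → EuclideanSpace ℝ (Fin 3)}
    {P : ℝ → EuclideanSpace ℝ (Fin 3) → ℝ}
    {G : ℝ → EuclideanSpace ℝ (Fin 3) → EuclideanSpace ℝ (Fin 3) →L[ℝ] EuclideanSpace ℝ (Fin 3)}
    (hsw : ∀ a : ℝ, 0 < a →
      IsSuitableWeakSolutionInBall a (0 : ℝ × EuclideanSpace ℝ (Fin 3)) U P)
    (hG : ∀ a : ℝ, 0 < a →
      HasWeakSpatialGradientOn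
        (parabolicCylinderOpens a (0 : ℝ × EuclideanSpace ℝ (Fin 3))) U G)
    (hI : ∀ a : ℝ, 0 < a →
      typeIBound (parabolicCylinder a (0 : ℝ × EuclideanSpace ℝ (Fin 3))) U P G ≤ M)
    (hD : ∀ z₀ : ℝ × EuclideanSpace ℝ (Fin 3), z₀.1 ≤ 0 →
      ∀ r : ℝ, 0 < r → cknD r z₀ P ≤ D₀)
    (hrate : ∀ s : ℝ, s < 0 →
      ∀ᵐ y : EuclideanSpace ℝ (Fin 3), ‖U s y‖ ≤ C / Real.sqrt (-s))
    (htop : ∀ φ : EuclideanSpace ℝ (Fin 3) → EuclideanSpace ℝ (Fin 3),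
      ContDiff ℝ (⊤ : ℕ∞) φ →
      HasCompactSupport φ → ∀ ε : ℝ, 0 < ε →
      ∃ s₀ : ℝ, s₀ < 0 ∧ ∀ᵐ s ∂(volume.restrict (Ioo s₀ 0)), |∫ y, ⟪U s y, φ y⟫| ≤ ε)
    (hC : C ^ 2 < 2) :
    ∀ x : EuclideanSpace ℝ (Fin 3), ¬ IsBackwardSingularPoint U ((0 : ℝ), x) := by
  intro x hx
  -- quiet-shell exclusion at EVERY ratio, from `hT` and `C² < 2`
  have hQA : ∀ A₀ : ℝ, 1 < A₀ →
      ∀ (U' : ℝ → EuclideanSpace ℝ (Fin 3) → EuclideanSpace ℝ (Fin 3))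
        (P' : ℝ → EuclideanSpace ℝ (Fin 3) → ℝ)
        (G' : ℝ → EuclideanSpace ℝ (Fin 3) →
          EuclideanSpace ℝ (Fin 3) →L[ℝ] EuclideanSpace ℝ (Fin 3)),
        (∀ a : ℝ, 0 < a →
          IsSuitableWeakSolutionInBall a (0 : ℝ × EuclideanSpace ℝ (Fin 3)) U' P') →
        (∀ a : ℝ, 0 < a →
          HasWeakSpatialGradientOn
            (parabolicCylinderOpens a (0 : ℝ × EuclideanSpace ℝ (Fin 3))) U' G') →
        (∀ a : ℝ, 0 < a →
          typeIBound (parabolicCylinder a (0 : ℝ × EuclideanSpace ℝ (Fin 3))) U' P' G' ≤ M) →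
        (∀ z₀ : ℝ × EuclideanSpace ℝ (Fin 3), z₀.1 ≤ 0 →
          ∀ r : ℝ, 0 < r → cknD r z₀ P' ≤ D₀) →
        (∀ s : ℝ, s < 0 →
          ∀ᵐ y : EuclideanSpace ℝ (Fin 3), ‖U' s y‖ ≤ C / Real.sqrt (-s)) →
        (∀ φ : EuclideanSpace ℝ (Fin 3) → EuclideanSpace ℝ (Fin 3),
          ContDiff ℝ (⊤ : ℕ∞) φ →
          HasCompactSupport φ → ∀ ε : ℝ, 0 < ε →
          ∃ s₀ : ℝ, s₀ < 0 ∧ ∀ᵐ s ∂(volume.restrict (Ioo s₀ 0)), |∫ y, ⟪U' s y, φ y⟫| ≤ ε) →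
        (∃ δ : ℝ, 0 < δ ∧ ∃ R : ℝ, 0 < R ∧ ∃ K : ℝ,
          ∀ᵐ z ∂(volume.restrict
            (Ioo (-δ) 0 ×ˢ {y : EuclideanSpace ℝ (Fin 3) | R < ‖y‖ ∧ ‖y‖ < A₀ * R})),
              ‖U' z.1 z.2‖ ≤ K) →
        ¬ IsBackwardSingularPoint U' (0 : ℝ × EuclideanSpace ℝ (Fin 3)) := by
    intro A₀ hA₀ U' P' G' hsw' hG' hI' hD' hrate' htop' hq hsing
    obtain ⟨δ, hδ, R, hR, K, hq⟩ := hq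
    have h2 := hT M D₀ C U' P' G' hsw' hG' hI' hD' hrate' htop' hsing A₀ R δ K hA₀ hR hδ hq
    linarith
  -- hence every closed shell about `x`, of every ratio, meets the (closed) top singular set
  have hmeet : ∀ R : ℝ, 0 < R → R < 1 → ∀ A : ℝ, 1 < A →
      ∃ y ∈ {y : EuclideanSpace ℝ (Fin 3) | IsBackwardSingularPoint U ((0 : ℝ), y)},
        R ≤ ‖y - x‖ ∧ ‖y - x‖ ≤ A * R := by
    intro R hR _ A hA
    obtain ⟨y, hy1, hy2, hy3⟩ :=
      exists_topSingular_mem_shell_of_quietShellExclusion hA (hQA A hA) hsw hG hI hD hrate htop hx hR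
    exact ⟨y, hy3, hy1, hy2⟩
  exact hausdorffMeasure_ne_zero_of_meets_every_shell (isClosed_topSingularSet U) x hmeet
    (hausdorffMeasure_topSingular_apex_eq_zero hsw)

/-- **COROLLARY — the registered LOUD stub (indeed Stub C) in the window `C² < 2`, from T27-A alone
(conditional record).**  Verbatim the statement of `stub_no_loudShellExtinctApex` of skeleton v4 with the
hypothesis `hT` (T27-A) and the single extra binder `C ^ 2 < 2` in front; neither the quiet-shell-exclusion
premise nor the loudness premise is used. -/
theorem stub_no_loudShellExtinctApex_of_rateSq_lt_two :
    ∀ (M D₀ : ℝ≥0) (C A₀ : ℝ), C ^ 2 < 2 → 1 < A₀ →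
    (∀ (U : ℝ → EuclideanSpace ℝ (Fin 3) → EuclideanSpace ℝ (Fin 3))
      (P : ℝ → EuclideanSpace ℝ (Fin 3) → ℝ)
      (G : ℝ → EuclideanSpace ℝ (Fin 3) →
        EuclideanSpace ℝ (Fin 3) →L[ℝ] EuclideanSpace ℝ (Fin 3)),
      (∀ a : ℝ, 0 < a →
        IsSuitableWeakSolutionInBall a (0 : ℝ × EuclideanSpace ℝ (Fin 3)) U P) →
      (∀ a : ℝ, 0 < a →
        HasWeakSpatialGradientOn
          (parabolicCylinderOpens a (0 : ℝ × EuclideanSpace ℝ (Fin 3))) U G) →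
      (∀ a : ℝ, 0 < a →
        typeIBound (parabolicCylinder a (0 : ℝ × EuclideanSpace ℝ (Fin 3))) U P G ≤ M) →
      (∀ z₀ : ℝ × EuclideanSpace ℝ (Fin 3), z₀.1 ≤ 0 →
        ∀ r : ℝ, 0 < r → cknD r z₀ P ≤ D₀) →
      (∀ s : ℝ, s < 0 →
        ∀ᵐ y : EuclideanSpace ℝ (Fin 3), ‖U s y‖ ≤ C / Real.sqrt (-s)) →
      (∀ φ : EuclideanSpace ℝ (Fin 3) → EuclideanSpace ℝ (Fin 3),
        ContDiff ℝ (⊤ : ℕ∞) φ →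
        HasCompactSupport φ → ∀ ε : ℝ, 0 < ε →
        ∃ s₀ : ℝ, s₀ < 0 ∧ ∀ᵐ s ∂(volume.restrict (Ioo s₀ 0)), |∫ y, ⟪U s y, φ y⟫| ≤ ε) →
      (∃ δ : ℝ, 0 < δ ∧ ∃ R : ℝ, 0 < R ∧ ∃ K : ℝ,
        ∀ᵐ z ∂(volume.restrict
          (Ioo (-δ) 0 ×ˢ {y : EuclideanSpace ℝ (Fin 3) | R < ‖y‖ ∧ ‖y‖ < A₀ * R})),
            ‖U z.1 z.2‖ ≤ K) →
      ¬ IsBackwardSingularPoint U (0 : ℝ × EuclideanSpace ℝ (Fin 3))) →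
    ∀ (U : ℝ → EuclideanSpace ℝ (Fin 3) → EuclideanSpace ℝ (Fin 3))
      (P : ℝ → EuclideanSpace ℝ (Fin 3) → ℝ)
      (G : ℝ → EuclideanSpace ℝ (Fin 3) →
        EuclideanSpace ℝ (Fin 3) →L[ℝ] EuclideanSpace ℝ (Fin 3)),
      (∀ a : ℝ, 0 < a →
        IsSuitableWeakSolutionInBall a (0 : ℝ × EuclideanSpace ℝ (Fin 3)) U P) →
      (∀ a : ℝ, 0 < a →
        HasWeakSpatialGradientOn
          (parabolicCylinderOpens a (0 : ℝ × EuclideanSpace ℝ (Fin 3))) U G) →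
      (∀ a : ℝ, 0 < a →
        typeIBound (parabolicCylinder a (0 : ℝ × EuclideanSpace ℝ (Fin 3))) U P G ≤ M) →
      (∀ z₀ : ℝ × EuclideanSpace ℝ (Fin 3), z₀.1 ≤ 0 →
        ∀ r : ℝ, 0 < r → cknD r z₀ P ≤ D₀) →
      (∀ s : ℝ, s < 0 →
        ∀ᵐ y : EuclideanSpace ℝ (Fin 3), ‖U s y‖ ≤ C / Real.sqrt (-s)) →
      (∀ φ : EuclideanSpace ℝ (Fin 3) → EuclideanSpace ℝ (Fin 3),
        ContDiff ℝ (⊤ : ℕ∞) φ →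
        HasCompactSupport φ → ∀ ε : ℝ, 0 < ε →
        ∃ s₀ : ℝ, s₀ < 0 ∧ ∀ᵐ s ∂(volume.restrict (Ioo s₀ 0)), |∫ y, ⟪U s y, φ y⟫| ≤ ε) →
      ¬ (∃ δ : ℝ, 0 < δ ∧ ∃ R : ℝ, 0 < R ∧ ∃ K : ℝ,
        ∀ᵐ z ∂(volume.restrict
          (Ioo (-δ) 0 ×ˢ {y : EuclideanSpace ℝ (Fin 3) | R < ‖y‖ ∧ ‖y‖ < A₀ * R})),
            ‖U z.1 z.2‖ ≤ K) →
      ¬ IsBackwardSingularPoint U (0 : ℝ × EuclideanSpace ℝ (Fin 3)) := by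
  intro M D₀ C A₀ hC _hA₀ _hQA U P G hsw hG hI hD hrate htop _hloud
  exact no_topSingular_of_rateSq_lt_two hT hsw hG hI hD hrate htop hC 0

/-- **Stub C in the window `C² < 2` (conditional record)**: given T27-A (`hT`), there is no backward-singular
extinct Type-I apex at all in a class with `C² < 2` — the form in which ROUND-27 cuts the open core: LOUD
survives only at `C ≥ √2`. -/
theorem no_extinctTypeIApex_of_rateSq_lt_two
    {M D₀ : ℝ≥0} {C : ℝ}
    {U : ℝ → EuclideanSpace ℝ (Fin 3) → EuclideanSpace ℝ (Fin 3)}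
    {P : ℝ → EuclideanSpace ℝ (Fin 3) → ℝ}
    {G : ℝ → EuclideanSpace ℝ (Fin 3) → EuclideanSpace ℝ (Fin 3) →L[ℝ] EuclideanSpace ℝ (Fin 3)}
    (hsw : ∀ a : ℝ, 0 < a →
      IsSuitableWeakSolutionInBall a (0 : ℝ × EuclideanSpace ℝ (Fin 3)) U P)
    (hG : ∀ a : ℝ, 0 < a →
      HasWeakSpatialGradientOn
        (parabolicCylinderOpens a (0 : ℝ × EuclideanSpace ℝ (Fin 3))) U G)
    (hI : ∀ a : ℝ, 0 < a →
      typeIBound (parabolicCylinder a (0 : ℝ × EuclideanSpace ℝ (Fin 3))) U P G ≤ M)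
    (hD : ∀ z₀ : ℝ × EuclideanSpace ℝ (Fin 3), z₀.1 ≤ 0 →
      ∀ r : ℝ, 0 < r → cknD r z₀ P ≤ D₀)
    (hrate : ∀ s : ℝ, s < 0 →
      ∀ᵐ y : EuclideanSpace ℝ (Fin 3), ‖U s y‖ ≤ C / Real.sqrt (-s))
    (htop : ∀ φ : EuclideanSpace ℝ (Fin 3) → EuclideanSpace ℝ (Fin 3),
      ContDiff ℝ (⊤ : ℕ∞) φ →
      HasCompactSupport φ → ∀ ε : ℝ, 0 < ε →
      ∃ s₀ : ℝ, s₀ < 0 ∧ ∀ᵐ s ∂(volume.restrict (Ioo s₀ 0)), |∫ y, ⟪U s y, φ y⟫| ≤ ε)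
    (hC : C ^ 2 < 2) :
    ¬ IsBackwardSingularPoint U (0 : ℝ × EuclideanSpace ℝ (Fin 3)) :=
  no_topSingular_of_rateSq_lt_two hT hsw hG hI hD hrate htop hC 0

/-- **T27-C (conditional record): item 18385 `TypeITraceScarL3` in the constant window `C² < 2ν`.**  IF T27-A
holds (`hT`) AND the constant-exposed Stub 2′ holds (`hZ`: a backward-singular apex of a classical Leray–Hopf
flow on `[0,T)` with eventual Type-I constant `C ≥ 0`, locally Type-I at the apex, with an `L³` terminal trace,
yields an extinct Type-I apex of class `(M, D₀, C/√ν)` that is backward singular at the origin — the same proof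
as the tree theorem `stub_extinctApexD_of_L3trace` with the constant carried through the viscosity
normalisation and the zoom), THEN a classical Leray–Hopf flow blowing up at `T` with EVENTUAL TYPE-I CONSTANT
`C`, `C² < 2ν`, leaves NO `L³` scar at any singular point.  Uses the landed Stub 1
`stub_localTypeI_of_typeIBlowup` by name; `max C 0` handles a negative constant.  In print the constant is only
known to be `≥ √ν/(8γ₃) ≈ 0.11√ν` (Leray 1934; arXiv:2111.03520 Thm 2.5). -/
theorem typeITraceScarL3_of_rateSq_lt_two_nu
    (hZ : ∀ (ν T : ℝ), 0 < ν → 0 < T →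
      ∀ (u : ℝ → EuclideanSpace ℝ (Fin 3) → EuclideanSpace ℝ (Fin 3))
        (p : ℝ → EuclideanSpace ℝ (Fin 3) → ℝ),
      IsClassicalNSSolutionOn (Ico 0 T) ν 0 u p → IsLerayHopfOn T ν 0 (u 0) u →
      ∀ C : ℝ, 0 ≤ C → (∀ᶠ t in 𝓝[<] T, ∀ x, ‖u t x‖ ≤ C / Real.sqrt (T - t)) →
      ∀ x₀ : EuclideanSpace ℝ (Fin 3),
      (∃ r₀ : ℝ, 0 < r₀ ∧
        ∃ G : ℝ → EuclideanSpace ℝ (Fin 3) →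
          EuclideanSpace ℝ (Fin 3) →L[ℝ] EuclideanSpace ℝ (Fin 3),
          HasWeakSpatialGradientOn (parabolicCylinderOpens r₀ (T, x₀)) u G ∧
          typeIBound (parabolicCylinder r₀ (T, x₀)) u p G < ⊤) →
      (∀ r : ℝ, 0 < r →
        eLpNorm (uncurry u) ⊤ (volume.restrict (parabolicCylinder r (T, x₀))) = ⊤) →
      (∃ ρ : ℝ, 0 < ρ ∧ MemLp (u T) 3 (volume.restrict (ball x₀ ρ))) →
        ∃ (U : ℝ → EuclideanSpace ℝ (Fin 3) → EuclideanSpace ℝ (Fin 3))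
          (P : ℝ → EuclideanSpace ℝ (Fin 3) → ℝ)
          (G : ℝ → EuclideanSpace ℝ (Fin 3) →
            EuclideanSpace ℝ (Fin 3) →L[ℝ] EuclideanSpace ℝ (Fin 3))
          (M D₀ : ℝ≥0),
          (∀ a : ℝ, 0 < a →
            IsSuitableWeakSolutionInBall a (0 : ℝ × EuclideanSpace ℝ (Fin 3)) U P) ∧
          (∀ a : ℝ, 0 < a →
            HasWeakSpatialGradientOn
              (parabolicCylinderOpens a (0 : ℝ × EuclideanSpace ℝ (Fin 3))) U G) ∧
          (∀ a : ℝ, 0 < a →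
            typeIBound (parabolicCylinder a (0 : ℝ × EuclideanSpace ℝ (Fin 3))) U P G ≤ M) ∧
          (∀ z₀ : ℝ × EuclideanSpace ℝ (Fin 3), z₀.1 ≤ 0 →
            ∀ r : ℝ, 0 < r → cknD r z₀ P ≤ D₀) ∧
          (∀ s : ℝ, s < 0 →
            ∀ᵐ y : EuclideanSpace ℝ (Fin 3), ‖U s y‖ ≤ (C / Real.sqrt ν) / Real.sqrt (-s)) ∧
          (∀ φ : EuclideanSpace ℝ (Fin 3) → EuclideanSpace ℝ (Fin 3),
            ContDiff ℝ (⊤ : ℕ∞) φ →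
            HasCompactSupport φ → ∀ ε : ℝ, 0 < ε →
            ∃ s₀ : ℝ, s₀ < 0 ∧ ∀ᵐ s ∂(volume.restrict (Ioo s₀ 0)), |∫ y, ⟪U s y, φ y⟫| ≤ ε) ∧
          IsBackwardSingularPoint U (0 : ℝ × EuclideanSpace ℝ (Fin 3))) :
    ∀ (ν T : ℝ), 0 < ν → 0 < T →
      ∀ (u : ℝ → EuclideanSpace ℝ (Fin 3) → EuclideanSpace ℝ (Fin 3))
        (p : ℝ → EuclideanSpace ℝ (Fin 3) → ℝ),
      IsClassicalNSSolutionOn (Ico 0 T) ν 0 u p → IsLerayHopfOn T ν 0 (u 0) u →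
      ∀ C : ℝ, C ^ 2 < 2 * ν → (∀ᶠ t in 𝓝[<] T, ∀ x, ‖u t x‖ ≤ C / Real.sqrt (T - t)) →
      ∀ x₀ : EuclideanSpace ℝ (Fin 3),
      (∀ r : ℝ, 0 < r →
        eLpNorm (uncurry u) ⊤ (volume.restrict (parabolicCylinder r (T, x₀))) = ⊤) →
      ∀ ρ : ℝ, 0 < ρ → ¬ MemLp (u T) 3 (volume.restrict (ball x₀ ρ)) := by
  intro ν T hν hTpos u p hsol hLH C hC hrate x₀ hsing ρ hρ htr
  -- the eventual constant may be taken nonnegative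
  have hrate' : ∀ᶠ t in 𝓝[<] T, ∀ x, ‖u t x‖ ≤ max C 0 / Real.sqrt (T - t) := by
    filter_upwards [hrate] with t ht x
    exact (ht x).trans (div_le_div_of_nonneg_right (le_max_left _ _) (Real.sqrt_nonneg _))
  have hC' : (max C 0) ^ 2 < 2 * ν := by
    rcases le_or_gt 0 C with h | h
    · rwa [max_eq_left h]
    · rw [max_eq_right h.le]; nlinarith
  have hTI : IsTypeIBlowup u T := ⟨max C 0, hrate'⟩
  -- Stub 1 (landed): the local Type-I quantity is finite at `(T, x₀)`
  have hloc :=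
    Summit.NavierStokesRegularity.NavierStokesRegularity.Theorems.TerminalTraceTypeITraceScarL3StubLocalTypeIOfTypeIBlowup.stub_localTypeI_of_typeIBlowup
      ν T hν hTpos u p hsol hLH hTI x₀
  -- Stub 2′ with the constant: an extinct apex of class `(M, D₀, max C 0 / √ν)`, singular at the origin
  obtain ⟨U, P, G, M, D₀, hswU, hGU, hIU, hDU, hrateU, htopU, hsingU⟩ :=
    hZ ν T hν hTpos u p hsol hLH (max C 0) (le_max_right _ _) hrate' x₀ hloc hsing ⟨ρ, hρ, htr⟩
  -- the window: `(max C 0 / √ν)² = (max C 0)²/ν < 2`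
  have hwin : (max C 0 / Real.sqrt ν) ^ 2 < 2 := by
    rw [div_pow, Real.sq_sqrt hν.le, div_lt_iff₀ hν]
    linarith
  exact no_topSingular_of_rateSq_lt_two hT hswU hGU hIU hDU hrateU htopU hwin 0 hsingU

end RateSqThreshold

end Summit.NavierStokesRegularity.NavierStokesRegularity.Theorems.TypeITraceScarL3

end
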